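import Summits.BirchSwinnertonDyer.BirchSwinnertonDyer.Theorems.ClassRecordThreeEulerHalvesAtThreeCartanDegreeLatticeLaw
import HarnessLib

/-!
# Crux 23422 `EulerHalvesAtThreeResidualUpperBound`, line `cartan`: the CARTAN DEGREE LAW (F2) DERIVED from (F2a) S-K1′ (`q ≥ 5`), (F2⁰) type-number-one
# transport and (F2b) the one-place hom-lattice dictionary — file 2/2: the induction on `#C` (derivation)

Seat `bsd-stepL-tam3-p1` (g20), LINE OWNER of crux 23422 (`--supports stmt-BirchSwinnertonDyer-23422 --as helper`). CONTENT = bsd-idea-10 g10's unregistered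
workfile `Cruxes/EulerHalvesAtThree/Lines/cartan_degree.lean` r2 (53799b0f4d965e0e) §4 (derivation) VERBATIM as to the proofs (the lattice law and `q = 2` are file 1/2 `…CartanDegreeLatticeLaw`; the transports are in
`…CartanDegreeDefs`), with its three `sorry`-stubs turned into HYPOTHESES (`hF2a : CubicTorusPeriodRatioAtThreeGeFive`,
`hF20 : CartanEmptyDegreeIndep`, `hF2b : CartanHomLatticeDictionaryAtThree`, the named `Prop`s of `…CartanDegreeDefs`) so that the file is sorry-free
and the line's skeleton v8 can state those three as its registered stubs and DERIVE v7's `stub_cartanDegreeLawAtThree` by `cartanDegreeLawAtThree_derived`.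
CREDIT: bsd-idea-10 g7–g10 (all proofs), idea-crit-14 (V49∕V57∕V70∕V79). HONEST FRAMING: theorems only; CONDITIONAL on the displayed hypotheses; nothing
is asserted about any curve; the degree law (F2) is NOT proved (it is derived from three open inputs, two beyond print); no summit statement, no route
item is proved; BSD is proved for no curve. References: [cite: KohenPacetti2016, Rem. 3.8 (p. 15), §2] [cite: CaiShuTian2014, §1.2 p. 5]
[cite: VignerasLNM800, Ch. III §5] [cite: PastenShimura2024, §2 p. 12 (admissible factorisation)].
-- adapted from Summits/BirchSwinnertonDyer/BirchSwinnertonDyer/Cruxes/EulerHalvesAtThree/Lines/cartan_degree.lean r2 (bsd-idea-10 g10), §1, §1b, §2, §4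
-/

set_option linter.dupNamespace false
set_option autoImplicit false

noncomputable section

open scoped Classical MatrixGroups NumberField UpperHalfPlane

namespace Summit.BirchSwinnertonDyer.BirchSwinnertonDyer.Theorems.CartanDegree

open WeierstrassCurve IsDedekindDomain NumberField Field Literature.NumberTheory.EllipticCurves
  Literature.NumberTheory.EllipticCurves.ModularForms
  Literature.NumberTheory.EllipticCurves.Rank1Residual Literature.NumberTheory.Automorphic
  Summit.BirchSwinnertonDyer.Rank1Residual Summit.BirchSwinnertonDyer.BirchSwinnertonDyer.Theorems

/-! ## §4 The derivation (PROVED): level arithmetic, class-minimal data at intermediate levels, induction on `#C` -/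

section Derivation

/-- Distinct primes: `∏_{q ∈ C} q^k ∣ m` as soon as each `q^k ∣ m`. [folklore] -/
theorem prod_pow_dvd_of_forall_dvd (k m : ℕ) :
    ∀ (C : Finset ℕ), (∀ q ∈ C, q.Prime) → (∀ q ∈ C, q ^ k ∣ m) → ∏ q ∈ C, q ^ k ∣ m := by
  intro C
  refine Finset.induction_on C (fun _ _ => by simp) ?_
  intro a s ha ih hp hd
  rw [Finset.prod_insert ha]
  refine Nat.Coprime.mul_dvd_of_dvd_of_dvd ?_ (hd a (Finset.mem_insert_self a s))
    (ih (fun q hq => hp q (Finset.mem_insert_of_mem hq)) (fun q hq => hd q (Finset.mem_insert_of_mem hq)))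
  refine Nat.Coprime.pow_left k (Nat.Coprime.prod_right fun q hq => Nat.Coprime.pow_right k ?_)
  exact (Nat.coprime_primes (hp a (Finset.mem_insert_self a s)) (hp q (Finset.mem_insert_of_mem hq))).mpr
    (fun h => ha (h ▸ hq))

/-- A class-minimal Cartan datum for `V` at an admissible level exists, by (F3) and well-ordering of `ℕ`. [folklore] -/
theorem exists_isMinimalFor_of_F3 (hF3 : nonempty_cartanParametrizationData)
    {N D M : ℕ} {C : Finset ℕ} (hadm : IsAdmissibleFactorization (D * M) D M)
    (hN : N = D * M * ∏ q ∈ C, q ^ 2) (hCp : ∀ q ∈ C, q.Prime ∧ ¬ q ∣ D * M)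
    (V : WeierstrassCurve ℚ) [V.IsElliptic] [V.IsGloballyMinimal] (hVN : V.conductorNorm ℤ = N)
    (hc : ∀ q ∈ C, ∃ _ : Fact q.Prime, 3 ∣ (V.baseChange ℚ_[q]).localTamagawaNumber ℤ_[q]) :
    ∃ (X : CartanLevelCurveData D M C) (W'' : WeierstrassCurve ℚ) (_ : W''.IsElliptic)
      (Q : CartanParametrizationData X W''), Q.IsMinimalFor V := by
  obtain ⟨⟨X⟩, h2⟩ := hF3 N D M C hadm hN hCp
  obtain ⟨Q₁⟩ := h2 X V hVN hc
  let P : ℕ → Prop := fun d => ∃ (W'' : WeierstrassCurve ℚ) (_ : W''.IsElliptic)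
      (Q : CartanParametrizationData X W''), V.IsIsogenous W'' ∧ Q.deg = d
  have hP : ∃ d, P d := ⟨Q₁.deg, V, inferInstance, Q₁, V.isIsogenous_self, rfl⟩
  obtain ⟨W'', hW'', Q, hiso, hdeg⟩ := Nat.find_spec hP
  refine ⟨X, W'', hW'', Q, hiso, fun W₃ _ Q₃ hiso₃ => ?_⟩
  rw [hdeg]
  exact Nat.find_min' hP ⟨W₃, ‹_›, Q₃, hiso₃, rfl⟩

/-- THE INDUCTION on the number of Cartan places, along the chain `(D, M; C) → (D, Mq²; C∖q) → … → (D, M₀; ∅)` with a FIXED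
class-minimal datum `Qt` at the top level `(D, M₀; ∅)`. -/
theorem degreeLaw_aux (hF3 : nonempty_cartanParametrizationData)
    (hF20 : CartanEmptyDegreeIndep) (hF2b : CartanHomLatticeDictionaryAtThree) (h2a : CubicTorusPeriodRatioAtThree)
    (V : WeierstrassCurve ℚ) [V.IsElliptic] [V.IsGloballyMinimal] (hX : ClassX11b V 3) (hsurj : Surj V 3)
    (N D M₀ : ℕ) (hVN : V.conductorNorm ℤ = N) (hadm : IsAdmissibleFactorization N D M₀)
    (Xt : CartanLevelCurveData D M₀ ∅) (Wt : WeierstrassCurve ℚ) [Wt.IsElliptic]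
    (Qt : CartanParametrizationData Xt Wt) (hQt : Qt.IsMinimalFor V) :
    ∀ (k : ℕ) (C : Finset ℕ) (M : ℕ), C.card = k → M * ∏ q ∈ C, q ^ 2 = M₀ →
      (∀ q ∈ C, ∃ _ : Fact q.Prime, q ≠ 3 ∧ q ^ 2 ∣ N ∧ ¬ q ^ 3 ∣ N ∧
        3 ∣ (V.baseChange ℚ_[q]).localTamagawaNumber ℤ_[q]) →
      ∀ (XC : CartanLevelCurveData D M C) (W'' : WeierstrassCurve ℚ) [W''.IsElliptic]
        (Q₀ : CartanParametrizationData XC W''), Q₀.IsMinimalFor V →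
        padicValNat 3 Q₀.deg + C.card = padicValNat 3 Qt.deg := by
  intro k
  induction k with
  | zero =>
    intro C M hcard hM hC XC W'' _ Q₀ hQ₀
    have hC0 : C = ∅ := Finset.card_eq_zero.mp hcard
    subst hC0
    simp only [Finset.prod_empty, mul_one] at hM
    subst hM
    have h := hF20 V D M XC W'' Q₀ Xt Wt Qt hQ₀ hQt
    simp [h]
  | succ k ih =>
    intro C M hcard hM hC XC W'' _ Q₀ hQ₀
    obtain ⟨q, hq⟩ : C.Nonempty := Finset.card_pos.mp (by omega)
    obtain ⟨hfq, hq3, _, hq3N, hcq⟩ := hC q hq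
    have hXcop := XC.coprime
    have hqP : q.Prime := (hXcop q hq).1
    -- the intermediate level `(D, M q²; C ∖ q)`
    have hcard' : (C.erase q).card = k := by rw [Finset.card_erase_of_mem hq, hcard]; rfl
    have hM' : M * q ^ 2 * ∏ p ∈ C.erase q, p ^ 2 = M₀ := by
      rw [mul_assoc, Finset.mul_prod_erase C (fun p => p ^ 2) hq, hM]
    have hDpos : 0 < D := hadm.pos_left
    have hM₀pos : 0 < M₀ := hadm.pos_right
    have hM'pos : 0 < M * q ^ 2 := by
      rcases Nat.eq_zero_or_pos (M * q ^ 2) with h0 | h0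
      · rw [h0, zero_mul] at hM'; omega
      · exact h0
    have hM'dvd : M * q ^ 2 ∣ M₀ := Dvd.intro _ hM'
    have hadm' : IsAdmissibleFactorization (D * (M * q ^ 2)) D (M * q ^ 2) :=
      ⟨Nat.mul_pos hDpos hM'pos, rfl, hadm.squarefree, hadm.even_card_primeFactors,
        Nat.Coprime.coprime_dvd_right hM'dvd hadm.coprime⟩
    have hN' : N = D * (M * q ^ 2) * ∏ p ∈ C.erase q, p ^ 2 := by
      rw [← hadm.mul_eq, ← hM']; ring
    have hCp' : ∀ p ∈ C.erase q, p.Prime ∧ ¬ p ∣ D * (M * q ^ 2) := by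
      intro p hp
      have hpq : p ≠ q := Finset.ne_of_mem_erase hp
      have hpC : p ∈ C := Finset.mem_of_mem_erase hp
      refine ⟨(hXcop p hpC).1, fun hdvd => ?_⟩
      rw [← mul_assoc] at hdvd
      rcases (Nat.Prime.dvd_mul (hXcop p hpC).1).mp hdvd with h1 | h1
      · exact (hXcop p hpC).2 h1
      · exact hpq ((Nat.prime_dvd_prime_iff_eq (hXcop p hpC).1 hqP).mp ((hXcop p hpC).1.dvd_of_dvd_pow h1))
    have hc' : ∀ p ∈ C.erase q, ∃ _ : Fact p.Prime, 3 ∣ (V.baseChange ℚ_[p]).localTamagawaNumber ℤ_[p] := by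
      intro p hp
      obtain ⟨hf, -, -, -, h3⟩ := hC p (Finset.mem_of_mem_erase hp)
      exact ⟨hf, h3⟩
    obtain ⟨X', W₂, hW₂, Q', hQ'⟩ := exists_isMinimalFor_of_F3 hF3 hadm' hN' hCp' V hVN hc'
    -- induction hypothesis on the intermediate datum
    have ih' := ih (C.erase q) (M * q ^ 2) hcard' hM'
      (fun p hp => hC p (Finset.mem_of_mem_erase hp)) X' W₂ Q' hQ'
    -- the one-place dictionary and S-K1′
    have hDMN : D * M * ∏ p ∈ C, p ^ 2 = N := by rw [← hadm.mul_eq, ← hM]; ring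
    obtain ⟨𝒟, h0, h1⟩ := hF2b V hX hsurj N D M C q XC W'' Q₀ X' W₂ Q'
      hVN hDMN hq hq3 hq3N hcq hQ₀ hQ'
    have hlaw := latticeDegreeLaw_of_periodRatio h2a q hqP hq3 𝒟
    rw [h0, h1] at hlaw
    rw [hcard]
    rw [hcard'] at ih'
    omega

/-- **(F2) DERIVED — the lead's `stub_cartanDegreeLawAtThree` (v6′ l.98–112 ∕ v7draft l.100–112) TOKEN-IDENTICALLY, from (F2a), (F2⁰),
(F2b) and the (F3) item as a hypothesis.** Proof: `N > 0` (`conductorNorm_pos_holds`); Pasten-admissibility of `(N, ∏S, N/∏S)`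
(`isAdmissibleFactorization_prod_of_even`); `∏_C q² ∣ N/∏S` (distinct primes, `q ∉ S` since `q² ∣ N`); the top datum is the TRANSPORT
`cartanOfShimura X`, `cpdOfSpd P₀` (class-minimal by `isMinimalFor_cpdOfSpd`); then `degreeLaw_aux` with `k = #C`. -/
theorem cartanDegreeLawAtThree_derived (hF3 : nonempty_cartanParametrizationData) (hF2a : CubicTorusPeriodRatioAtThreeGeFive)
    (hF20 : CartanEmptyDegreeIndep) (hF2b : CartanHomLatticeDictionaryAtThree) :
    ∀ (V : WeierstrassCurve ℚ) [V.IsElliptic] [V.IsGloballyMinimal], ClassX11b V 3 → Surj V 3 →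
      ∀ (N : ℕ) (S C : Finset ℕ)
        (X : ShimuraCurveData (∏ q ∈ S, q) (N / ∏ q ∈ S, q))
        (W' : WeierstrassCurve ℚ) [W'.IsElliptic] (P₀ : ShimuraParametrizationData X W')
        (XC : Literature.NumberTheory.Automorphic.CartanLevelCurveData (∏ q ∈ S, q) (N / ((∏ q ∈ S, q) * ∏ q ∈ C, q ^ 2)) C)
        (W'' : WeierstrassCurve ℚ) [W''.IsElliptic] (Q₀ : Literature.NumberTheory.Automorphic.CartanParametrizationData XC W''),
        V.conductorNorm ℤ = N → (∀ ℓ ∈ S, ℓ.Prime ∧ ℓ ∣ N ∧ ¬ ℓ ^ 2 ∣ N) → Even S.card →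
        (∀ q ∈ C, ∃ _ : Fact q.Prime, q ≠ 3 ∧ q ^ 2 ∣ N ∧ ¬ q ^ 3 ∣ N ∧
          3 ∣ (V.baseChange ℚ_[q]).localTamagawaNumber ℤ_[q]) →
        P₀.IsMinimalFor V → Q₀.IsMinimalFor V →
        padicValNat 3 Q₀.deg + C.card = padicValNat 3 P₀.deg := by
  intro V _ _ hX hsurj N S C X W' _ P₀ XC W'' _ Q₀ hN hS hSe hC hP₀ hQ₀
  have hNpos : 0 < N := by
    have h : 0 < V.conductorNorm ℤ := V.conductorNorm_pos_holds
    rwa [hN] at h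
  have hadm := isAdmissibleFactorization_prod_of_even hNpos hS hSe
  have hDpos : 0 < ∏ q ∈ S, q := hadm.pos_left
  -- `∏_C q² ∣ N / ∏S`
  have hCprime : ∀ q ∈ C, q.Prime := fun q hq => (hC q hq).1.out
  have hPC : ∏ q ∈ C, q ^ 2 ∣ N / ∏ q ∈ S, q := by
    refine prod_pow_dvd_of_forall_dvd 2 _ C hCprime fun q hq => ?_
    obtain ⟨hfq, -, hq2N, -, -⟩ := hC q hq
    have hqS : Nat.Coprime (q ^ 2) (∏ ℓ ∈ S, ℓ) := by
      refine Nat.Coprime.pow_left 2 (Nat.Coprime.prod_right fun ℓ hℓ => ?_)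
      refine (Nat.coprime_primes hfq.out (hS ℓ hℓ).1).mpr fun h => ?_
      subst h
      exact (hS q hℓ).2.2 hq2N
    rw [← hadm.mul_eq] at hq2N
    exact hqS.dvd_of_dvd_mul_left hq2N
  have hPpos : 0 < ∏ q ∈ C, q ^ 2 := Finset.prod_pos fun q hq => pow_pos (hCprime q hq).pos 2
  obtain ⟨M, hM⟩ := hPC
  have hMeq : N / ((∏ q ∈ S, q) * ∏ q ∈ C, q ^ 2) = M := by
    rw [← Nat.div_div_eq_div_mul, hM, Nat.mul_div_cancel_left M hPpos]
  have hlevel : N / ((∏ q ∈ S, q) * ∏ q ∈ C, q ^ 2) * ∏ q ∈ C, q ^ 2 = N / ∏ q ∈ S, q := by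
    rw [hMeq, hM, mul_comm]
  have key := degreeLaw_aux hF3 hF20 hF2b (cubicTorusPeriodRatioAtThree_of_geFive hF2a) V hX hsurj N (∏ q ∈ S, q) (N / ∏ q ∈ S, q) hN hadm
    (cartanOfShimura X) W' (cpdOfSpd P₀) (isMinimalFor_cpdOfSpd hP₀) C.card C _ rfl hlevel hC XC W'' Q₀ hQ₀
  simpa using key

end Derivation

end Summit.BirchSwinnertonDyer.BirchSwinnertonDyer.Theorems.CartanDegree

end
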